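import Summits.CriticalPhenomena.SAWScalingLimit.Theorems.SAWDefectDecoherenceBoundaryClosureRPolygonGreenBoundary
import Summits.CriticalPhenomena.SAWScalingLimit.Theorems.SAWDefectDecoherenceBoundaryClosureRSidePhaseCornerGeometry
import HarnessLib

/-!
# Dart sums on a flat boundary ball: phase factorisation and comparison with boundary mass sums
(crux `BoundaryClosureR`, stmt-CriticalPhenomena-14004, line `polygon-parity-squeeze`, sub-goal of the
registered stub `polygonLocalIdentity`, steps (a)/(c); registered helper `dartSum_eq_phase_mul_massSum`)

Finite-sum algebra behind the local continuum identity, for ONE domain `Λ` at mesh `δ`: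

* `dartSum_eq_phase_mul_massSum`: if on the ball carrying the support of `φ` every boundary dart
  `v ∼ t` heads in the direction `c_t - c_v = -n_k/√3` and carries the phase `P`
  (`F(vt)·|F₀(b)| = P·|F₀(vt)|·F(b)`), then the dart term of the discrete Green pairing factorises,
  `6δ Σ_{darts} φ(δc_v)(mid - c_v) F(vt)/F(b) = -√3·n_k·P·[δ Σ_{darts} φ(δc_v) |F₀(vt)|/|F₀(b)|]`;
* `norm_massSum_darts_sub_boundary_le`: the bracket differs from the boundary mass pairing
  `δ Σ_{e ∈ ∂Ω} φ(δ·mid e)|F₀(e)|/|F₀(b)|` by at most `(L δ/2)·δ Σ_{e ∈ ∂Ω} w₀(δ·mid e)|F₀(e)|/|F₀(b)|`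
  (`L` a Lipschitz constant of `φ`, `w₀ ≥ 0` equal to `1` near the support of `φ`);
* `boundarySum_re_add_im`: the complex boundary pairing splits into its real and imaginary parts.

References: Duminil-Copin–Smirnov 2012 §3.  No definition is introduced.
-/

noncomputable section

open scoped BigOperators ComplexConjugate
open Set Metric Complex
open Literature.Probability.LatticeModels Literature.Probability.RandomPlanarGeometry
open Literature.Probability.RandomPlanarGeometry.SAW
open Literature.Barriers.CriticalPhenomena.HexGreen (nbrs mem_nbrs_iff)
open Summit.CriticalPhenomena.SAWScalingLimit.Theorems (DecoherenceSynthesis.norm_hexMidpoint_sub_hexCenter_le)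
open Summit.CriticalPhenomena.SAWScalingLimit.Theorems.PolygonParitySqueeze.PolygonGreen (sum_darts_eq_finsum
  finsum_boundary_eq_sum_darts)

namespace Summit.CriticalPhenomena.SAWScalingLimit.Theorems.PolygonParitySqueeze.PolygonLocal

/-! ### 1. The phase factorisation of the dart term -/

/-- `6 · (-(√3)⁻¹/2) = -√3`. [folklore] -/
theorem six_mul_neg_inv_sqrt_three_div_two : (6 : ℂ) * (-(((Real.sqrt 3)⁻¹ : ℝ) : ℂ) / 2) = -(Real.sqrt 3 : ℂ) := by
  have h3 : Real.sqrt 3 * Real.sqrt 3 = 3 := Real.mul_self_sqrt (by norm_num)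
  have h0 : Real.sqrt 3 ≠ 0 := Real.sqrt_ne_zero'.2 (by norm_num)
  have : ((Real.sqrt 3)⁻¹ : ℝ) = Real.sqrt 3 / 3 := by
    field_simp; linarith [h3]
  rw [this]; push_cast; ring

/-- **Phase factorisation of the dart term.**  If every boundary dart `v ∼ t` (`v ∈ Λ ∌ t`) with
`δ c_v ∈ B(z, R) ⊇ tsupport φ` satisfies `c_t - c_v = -n_k/√3` and `F(vt)·|F₀(b)| = P·|F₀(vt)|·F(b)`,
and `F(b) ≠ 0 ≠ |F₀(b)|`, then
`6δ Σ_{darts} φ(δc_v)(mid - c_v)F(vt)/F(b) = -√3 n_k P · δ Σ_{darts} φ(δc_v)|F₀(vt)|/|F₀(b)|`.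
[cite: DuminilCopinSmirnov2012, §3 (winding of walks to the boundary)] -/
theorem dartSum_eq_phase_mul_massSum : ∀ (Λ : Finset HexVertex) (ar br : Sym2 HexVertex) (δ : ℝ) (φ : ℂ → ℂ) (z : ℂ) (R : ℝ) (k : Fin 6) (P : ℂ), tsupport φ ⊆ Metric.ball z R → hexParafermionicObservable Λ ar hexCriticalFugacity (5 / 8) br ≠ 0 → ‖hexParafermionicObservable Λ ar hexCriticalFugacity 0 br‖ ≠ 0 → (∀ v t : HexVertex, v ∈ Λ → t ∉ Λ → hexGraph.Adj v t → (δ : ℂ) * hexCenter v ∈ Metric.ball z R → hexCenter t - hexCenter v = -(((Real.sqrt 3)⁻¹ : ℝ) : ℂ) * innerNormal k) → (∀ v t : HexVertex, v ∈ Λ → t ∉ Λ → hexGraph.Adj v t → (δ : ℂ) * hexCenter v ∈ Metric.ball z R → hexParafermionicObservable Λ ar hexCriticalFugacity (5 / 8) s(v, t) * ((‖hexParafermionicObservable Λ ar hexCriticalFugacity 0 br‖ : ℝ) : ℂ) = P * ((‖hexParafermionicObservable Λ ar hexCriticalFugacity 0 s(v, t)‖ : ℝ) : ℂ) * hexParafermionicObservable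 Λ ar hexCriticalFugacity (5 / 8) br) → 6 * (δ : ℂ) * ∑ᶠ p ∈ {p : HexVertex × HexVertex | p.1 ∈ Λ ∧ p.2 ∉ Λ ∧ hexGraph.Adj p.1 p.2}, φ ((δ : ℂ) * hexCenter p.1) * (hexMidpoint s(p.1, p.2) - hexCenter p.1) * (hexParafermionicObservable Λ ar hexCriticalFugacity (5 / 8) s(p.1, p.2) / hexParafermionicObservable Λ ar hexCriticalFugacity (5 / 8) br) = -(Real.sqrt 3 : ℂ) * innerNormal k * P * ((δ : ℂ) * ∑ᶠ p ∈ {p : HexVertex × HexVertex | p.1 ∈ Λ ∧ p.2 ∉ Λ ∧ hexGraph.Adj p.1 p.2}, φ ((δ : ℂ) * hexCenter p.1) * ((‖hexParafermionicObservable Λ ar hexCriticalFugacity 0 s(p.1, p.2)‖ / ‖hexParafermionicObservable Λ ar hexCriticalFugacity 0 br‖ : ℝ) : ℂ)) := by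
  intro Λ ar br δ φ z R k P hsupp hFb hZb hdir hphase
  rw [← sum_darts_eq_finsum (M := ℂ) Λ (fun p : HexVertex × HexVertex => φ ((δ : ℂ) * hexCenter p.1) *
      (hexMidpoint s(p.1, p.2) - hexCenter p.1) *
      (hexParafermionicObservable Λ ar hexCriticalFugacity (5 / 8) s(p.1, p.2) /
        hexParafermionicObservable Λ ar hexCriticalFugacity (5 / 8) br)),
    ← sum_darts_eq_finsum (M := ℂ) Λ (fun p : HexVertex × HexVertex => φ ((δ : ℂ) * hexCenter p.1) *
      ((‖hexParafermionicObservable Λ ar hexCriticalFugacity 0 s(p.1, p.2)‖ /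
        ‖hexParafermionicObservable Λ ar hexCriticalFugacity 0 br‖ : ℝ) : ℂ))]
  simp only [Finset.mul_sum]
  refine Finset.sum_congr rfl fun v hv => Finset.sum_congr rfl fun t ht => ?_
  rw [Finset.mem_filter, mem_nbrs_iff] at ht
  obtain ⟨hvt, htΛ⟩ := ht
  by_cases hφ : φ ((δ : ℂ) * hexCenter v) = 0
  · rw [hφ]; simp
  have hvR : (δ : ℂ) * hexCenter v ∈ ball z R := hsupp (subset_tsupport _ hφ)
  have hd := hdir v t hv htΛ hvt hvR
  have hp := hphase v t hv htΛ hvt hvR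
  have hmid : hexMidpoint s(v, t) - hexCenter v = -(((Real.sqrt 3)⁻¹ : ℝ) : ℂ) * innerNormal k / 2 := by
    rw [hexMidpoint_mk, show hexCenter t = hexCenter v + (hexCenter t - hexCenter v) by ring, hd]; ring
  have hZb' : ((‖hexParafermionicObservable Λ ar hexCriticalFugacity 0 br‖ : ℝ) : ℂ) ≠ 0 :=
    Complex.ofReal_ne_zero.2 hZb
  have hratio : hexParafermionicObservable Λ ar hexCriticalFugacity (5 / 8) s(v, t) /
      hexParafermionicObservable Λ ar hexCriticalFugacity (5 / 8) br =
      P * ((‖hexParafermionicObservable Λ ar hexCriticalFugacity 0 s(v, t)‖ /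
        ‖hexParafermionicObservable Λ ar hexCriticalFugacity 0 br‖ : ℝ) : ℂ) := by
    rw [div_eq_iff hFb, Complex.ofReal_div]
    field_simp
    linear_combination hp
  rw [hratio, hmid]
  have h6 := six_mul_neg_inv_sqrt_three_div_two
  linear_combination (φ ((δ : ℂ) * hexCenter v) * innerNormal k * P * (δ : ℂ) *
    ((‖hexParafermionicObservable Λ ar hexCriticalFugacity 0 s(v, t)‖ /
      ‖hexParafermionicObservable Λ ar hexCriticalFugacity 0 br‖ : ℝ) : ℂ)) * h6

/-! ### 2. Dart mass sums versus boundary mass sums -/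

/-- **The dart mass pairing is close to the boundary mass pairing.**  With `L` a Lipschitz constant of
`φ` and `w₀ ≥ 0` equal to `1` within `δ` of every point where `φ ≠ 0`,
`‖δ Σ_{darts} φ(δc_v)|F₀|/|F₀(b)| - δ Σ_{e ∈ ∂Ω} φ(δ·mid e)|F₀(e)|/|F₀(b)|‖ ≤ (Lδ/2)·δ Σ_{e ∈ ∂Ω} w₀(δ·mid e)|F₀(e)|/|F₀(b)|`.
[folklore] -/
theorem norm_massSum_darts_sub_boundary_le (Λ : Finset HexVertex) (ar br : Sym2 HexVertex) {δ : ℝ}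
    (hδ : 0 ≤ δ) (φ : ℂ → ℂ) (w₀ : ℂ → ℝ) {L : ℝ} (hL : 0 ≤ L) (hlip : ∀ x y, ‖φ x - φ y‖ ≤ L * ‖x - y‖)
    (hw0 : ∀ y, 0 ≤ w₀ y) (hw1 : ∀ y y', φ y ≠ 0 → dist y' y ≤ δ → w₀ y' = 1) :
    ‖(δ : ℂ) * ∑ᶠ p ∈ {p : HexVertex × HexVertex | p.1 ∈ Λ ∧ p.2 ∉ Λ ∧ hexGraph.Adj p.1 p.2},
        φ ((δ : ℂ) * hexCenter p.1) *
          ((‖hexParafermionicObservable Λ ar hexCriticalFugacity 0 s(p.1, p.2)‖ /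
            ‖hexParafermionicObservable Λ ar hexCriticalFugacity 0 br‖ : ℝ) : ℂ) -
      (δ : ℂ) * ∑ᶠ e ∈ hexDomainBoundary Λ, φ ((δ : ℂ) * hexMidpoint e) *
          ((‖hexParafermionicObservable Λ ar hexCriticalFugacity 0 e‖ /
            ‖hexParafermionicObservable Λ ar hexCriticalFugacity 0 br‖ : ℝ) : ℂ)‖ ≤
      L * δ / 2 * (δ * ∑ᶠ e ∈ hexDomainBoundary Λ, w₀ ((δ : ℂ) * hexMidpoint e) *
          (‖hexParafermionicObservable Λ ar hexCriticalFugacity 0 e‖ /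
            ‖hexParafermionicObservable Λ ar hexCriticalFugacity 0 br‖)) := by
  set Zr : Sym2 HexVertex → ℝ := fun e => ‖hexParafermionicObservable Λ ar hexCriticalFugacity 0 e‖ /
    ‖hexParafermionicObservable Λ ar hexCriticalFugacity 0 br‖ with hZr
  have hZr0 : ∀ e, 0 ≤ Zr e := fun e => div_nonneg (norm_nonneg _) (norm_nonneg _)
  rw [← sum_darts_eq_finsum (M := ℂ) Λ (fun p : HexVertex × HexVertex => φ ((δ : ℂ) * hexCenter p.1) *
      ((Zr s(p.1, p.2) : ℝ) : ℂ)),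
    finsum_boundary_eq_sum_darts Λ (fun e => φ ((δ : ℂ) * hexMidpoint e) * ((Zr e : ℝ) : ℂ)),
    finsum_boundary_eq_sum_darts Λ (fun e => w₀ ((δ : ℂ) * hexMidpoint e) * Zr e)]
  rw [← mul_sub, ← Finset.sum_sub_distrib, Finset.mul_sum, Finset.mul_sum, Finset.mul_sum]
  refine (norm_sum_le _ _).trans (Finset.sum_le_sum fun v hv => ?_)
  rw [← Finset.sum_sub_distrib, Finset.mul_sum, Finset.mul_sum, Finset.mul_sum]
  refine (norm_sum_le _ _).trans (Finset.sum_le_sum fun t ht => ?_)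
  rw [Finset.mem_filter, mem_nbrs_iff] at ht
  obtain ⟨hvt, -⟩ := ht
  -- termwise
  have hkey : ‖φ ((δ : ℂ) * hexCenter v) - φ ((δ : ℂ) * hexMidpoint s(v, t))‖ ≤
      L * δ / 2 * w₀ ((δ : ℂ) * hexMidpoint s(v, t)) := by
    by_cases h0 : φ ((δ : ℂ) * hexCenter v) = 0 ∧ φ ((δ : ℂ) * hexMidpoint s(v, t)) = 0
    · rw [h0.1, h0.2, sub_zero, norm_zero]
      exact mul_nonneg (by positivity) (hw0 _)
    · have hdist : dist ((δ : ℂ) * hexMidpoint s(v, t)) ((δ : ℂ) * hexCenter v) ≤ δ := by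
        rw [dist_comm, dist_eq_norm, ← mul_sub, norm_mul, Complex.norm_real, Real.norm_of_nonneg hδ]
        have := DecoherenceSynthesis.norm_hexMidpoint_sub_hexCenter_le hvt
        rw [norm_sub_rev] at this
        nlinarith [norm_nonneg (hexCenter v - hexMidpoint s(v, t))]
      have hw : w₀ ((δ : ℂ) * hexMidpoint s(v, t)) = 1 := by
        rw [not_and_or] at h0
        rcases h0 with h | h
        · exact hw1 _ _ h hdist
        · exact hw1 _ _ h (by rw [dist_self]; exact hδ)
      rw [hw, mul_one]
      calc ‖φ ((δ : ℂ) * hexCenter v) - φ ((δ : ℂ) * hexMidpoint s(v, t))‖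
          ≤ L * ‖(δ : ℂ) * hexCenter v - (δ : ℂ) * hexMidpoint s(v, t)‖ := hlip _ _
        _ = L * (δ * ‖hexCenter v - hexMidpoint s(v, t)‖) := by
            rw [← mul_sub, norm_mul, Complex.norm_real, Real.norm_of_nonneg hδ]
        _ ≤ L * (δ * (1 / 2)) := by
            gcongr; rw [norm_sub_rev]; exact DecoherenceSynthesis.norm_hexMidpoint_sub_hexCenter_le hvt
        _ = L * δ / 2 := by ring
  calc ‖(δ : ℂ) * (φ ((δ : ℂ) * hexCenter v) * ((Zr s(v, t) : ℝ) : ℂ) -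
        φ ((δ : ℂ) * hexMidpoint s(v, t)) * ((Zr s(v, t) : ℝ) : ℂ))‖
      = δ * (‖φ ((δ : ℂ) * hexCenter v) - φ ((δ : ℂ) * hexMidpoint s(v, t))‖ * Zr s(v, t)) := by
        rw [← sub_mul, norm_mul, norm_mul, Complex.norm_real, Complex.norm_real, Real.norm_of_nonneg hδ,
          Real.norm_of_nonneg (hZr0 _)]
    _ ≤ δ * (L * δ / 2 * w₀ ((δ : ℂ) * hexMidpoint s(v, t)) * Zr s(v, t)) := by
        gcongr
    _ = L * δ / 2 * (δ * (w₀ ((δ : ℂ) * hexMidpoint s(v, t)) * Zr s(v, t))) := by ring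

/-! ### 3. Real and imaginary parts of the boundary pairing -/

/-- **The complex boundary mass pairing splits into real and imaginary parts**:
`δ Σ φ(δ·mid e)·Z_e = (δ Σ Re φ(δ·mid e)·Z_e) + (δ Σ Im φ(δ·mid e)·Z_e)·i`. [folklore] -/
theorem boundarySum_re_add_im (Λ : Finset HexVertex) (ar br : Sym2 HexVertex) (δ : ℝ) (φ : ℂ → ℂ) :
    (δ : ℂ) * ∑ᶠ e ∈ hexDomainBoundary Λ, φ ((δ : ℂ) * hexMidpoint e) *
        ((‖hexParafermionicObservable Λ ar hexCriticalFugacity 0 e‖ /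
          ‖hexParafermionicObservable Λ ar hexCriticalFugacity 0 br‖ : ℝ) : ℂ) =
      ((δ * ∑ᶠ e ∈ hexDomainBoundary Λ, (φ ((δ : ℂ) * hexMidpoint e)).re *
          (‖hexParafermionicObservable Λ ar hexCriticalFugacity 0 e‖ /
            ‖hexParafermionicObservable Λ ar hexCriticalFugacity 0 br‖) : ℝ) : ℂ) +
      ((δ * ∑ᶠ e ∈ hexDomainBoundary Λ, (φ ((δ : ℂ) * hexMidpoint e)).im *
          (‖hexParafermionicObservable Λ ar hexCriticalFugacity 0 e‖ /
            ‖hexParafermionicObservable Λ ar hexCriticalFugacity 0 br‖) : ℝ) : ℂ) * Complex.I := by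
  set Zr : Sym2 HexVertex → ℝ := fun e => ‖hexParafermionicObservable Λ ar hexCriticalFugacity 0 e‖ /
    ‖hexParafermionicObservable Λ ar hexCriticalFugacity 0 br‖ with hZr
  rw [finsum_boundary_eq_sum_darts Λ (fun e => φ ((δ : ℂ) * hexMidpoint e) * ((Zr e : ℝ) : ℂ)),
    finsum_boundary_eq_sum_darts Λ (fun e => (φ ((δ : ℂ) * hexMidpoint e)).re * Zr e),
    finsum_boundary_eq_sum_darts Λ (fun e => (φ ((δ : ℂ) * hexMidpoint e)).im * Zr e)]
  apply Complex.ext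
  · simp [Complex.re_sum, Finset.mul_sum]
  · simp [Complex.im_sum, Finset.mul_sum]

end Summit.CriticalPhenomena.SAWScalingLimit.Theorems.PolygonParitySqueeze.PolygonLocal

end
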